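import Summits.AtomisticToContinuum.BoseEinsteinCondensation.Theorems.BECCutLineWeakDisorderOccupationStability
import Literature.MathematicalPhysics.QuantumManyBody.SwapPurity

/-!
# Route `BECSwapNoCatastrophe` — support item `SwapToZeroMode` (stmt-AtomisticToContinuum-14397):
occupation stability for measurable wave functions

Helper file for `Summit.AtomisticToContinuum.BoseEinsteinCondensation.Theses.BECSwapNoCatastrophe.SwapToZeroMode`.
The `√N`-Lipschitz bound `occ(u, Ψ)^{1/2} ≤ occ(u, Φ)^{1/2} + N^{1/2} ‖Ψ - cΦ‖₂` of
`occupationStability_proof` (stmt-AtomisticToContinuum-9074, Dirichlet trial states) restated for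
arbitrary MEASURABLE `N`-body functions `Ψ, Φ : (ℝ³)^N → ℂ` — the form needed for the cell-indicator
functions `1_{cell^N} Ψ` of periodic states, whose occupations `cellOccupation`/`condensateOccupation`
are the objects of the torus glue `SwapToZeroMode`. The proof is the same bookkeeping
(pointwise slice bound `nnnorm_integral_conj_mul_le_add`, Minkowski in `L²(dY)`, Tonelli).
-/

noncomputable section

namespace Summit.AtomisticToContinuum.BoseEinsteinCondensation.Theorems

open MeasureTheory
open scoped ENNReal NNReal ComplexConjugate
open Literature.MathematicalPhysics.QuantumManyBody.BoseGas

namespace SwapToZeroMode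

/-- `Y ↦ ∫ conj(u x) Θ(x :: Y) dx` is a.e.-strongly measurable for an a.e.-strongly measurable mode
`u` and a measurable `Θ` (Fubini measurability of a parametric Bochner integral). [folklore] -/
theorem aestronglyMeasurable_pairing_of_measurable {n : ℕ} {u : Space → ℂ}
    (hu : AEStronglyMeasurable u volume) {Θ : Config (n + 1) → ℂ} (hΘ : Measurable Θ) :
    AEStronglyMeasurable (fun Y : Config n => ∫ x, conj (u x) * Θ (Matrix.vecCons x Y)) volume := by
  have hF : AEStronglyMeasurable
      (fun p : Config n × Space => conj (u p.2) * Θ (Matrix.vecCons p.2 p.1))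
      ((volume : Measure (Config n)).prod (volume : Measure Space)) :=
    (Complex.continuous_conj.comp_aestronglyMeasurable hu.comp_snd).mul
      (hΘ.comp (continuous_snd.matrixVecCons continuous_fst).measurable).aestronglyMeasurable
  exact hF.integral_prod_right'

open OccupationStability in
/-- **Occupation stability for measurable wave functions**: for a normalised a.e.-strongly
measurable mode `u` (`∫ |u|² = 1`), measurable `Ψ, Φ : (ℝ³)^{n+1} → ℂ` and `|c| = 1`,
`occ(u, Ψ)^{1/2} ≤ occ(u, Φ)^{1/2} + (n+1)^{1/2} (∫ |Ψ - cΦ|²)^{1/2}` — `√occ(u, ·)` is a seminorm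
dominated by `√N ‖·‖₂`. [cite: LSSY2005, §1.2 (1.17)] -/
theorem occupation_rpow_half_le_add {n : ℕ} {u : Space → ℂ} (hu : AEStronglyMeasurable u volume)
    (hu1 : ∫⁻ x, (‖u x‖₊ : ℝ≥0∞) ^ 2 = 1) {Ψ Φ : Config (n + 1) → ℂ} (hΨ : Measurable Ψ)
    (hΦ : Measurable Φ) {c : ℂ} (hc : ‖c‖ = 1) :
    occupation (n + 1) u Ψ ^ (1 / 2 : ℝ) ≤
      occupation (n + 1) u Φ ^ (1 / 2 : ℝ) +
        ((n + 1 : ℕ) : ℝ≥0∞) ^ (1 / 2 : ℝ) * (∫⁻ X, (‖Ψ X - c * Φ X‖₊ : ℝ≥0∞) ^ 2) ^ (1 / 2 : ℝ) := by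
  have hocc : ∀ Θ : Config (n + 1) → ℂ, occupation (n + 1) u Θ =
      (n + 1 : ℝ≥0∞) * ∫⁻ Y : Config n,
        (‖∫ x, conj (u x) * Θ (Matrix.vecCons x Y)‖₊ : ℝ≥0∞) ^ 2 := fun Θ => rfl
  have hN : ((n + 1 : ℕ) : ℝ≥0∞) = (n + 1 : ℝ≥0∞) := by push_cast; rfl
  have hDm : Measurable fun X => Ψ X - c * Φ X := hΨ.sub (measurable_const.mul hΦ)
  -- Tonelli in `X = x :: Y`
  have hTon : ∫⁻ X, (‖Ψ X - c * Φ X‖₊ : ℝ≥0∞) ^ 2 =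
      ∫⁻ Y : Config n, ∫⁻ x : Space,
        (‖Ψ (Matrix.vecCons x Y) - c * Φ (Matrix.vecCons x Y)‖₊ : ℝ≥0∞) ^ 2 :=
    (lintegral_lintegral_sq_nnnorm_vecCons hDm).symm
  -- Minkowski in `L²(dY)` on top of the pointwise slice bound
  have key : (∫⁻ Y : Config n,
        (‖∫ x, conj (u x) * Ψ (Matrix.vecCons x Y)‖₊ : ℝ≥0∞) ^ 2) ^ (1 / 2 : ℝ) ≤
      (∫⁻ Y : Config n,
          (‖∫ x, conj (u x) * Φ (Matrix.vecCons x Y)‖₊ : ℝ≥0∞) ^ 2) ^ (1 / 2 : ℝ) +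
        (∫⁻ Y : Config n, ∫⁻ x : Space,
          (‖Ψ (Matrix.vecCons x Y) - c * Φ (Matrix.vecCons x Y)‖₊ : ℝ≥0∞) ^ 2) ^
            (1 / 2 : ℝ) := by
    set f : Config n → ℝ≥0∞ := fun Y =>
      (‖∫ x, conj (u x) * Φ (Matrix.vecCons x Y)‖₊ : ℝ≥0∞) with hf
    set g : Config n → ℝ≥0∞ := fun Y => (∫⁻ x : Space,
      (‖Ψ (Matrix.vecCons x Y) - c * Φ (Matrix.vecCons x Y)‖₊ : ℝ≥0∞) ^ 2) ^ (1 / 2 : ℝ)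
      with hg
    have hfm : AEMeasurable f volume :=
      (aestronglyMeasurable_pairing_of_measurable hu hΦ).aemeasurable.nnnorm.coe_nnreal_ennreal
    have hgm : AEMeasurable g volume :=
      ((measurable_lintegral_sq_nnnorm_vecCons hDm).pow_const _).aemeasurable
    have hg2 : ∀ Y, g Y ^ 2 = ∫⁻ x : Space,
        (‖Ψ (Matrix.vecCons x Y) - c * Φ (Matrix.vecCons x Y)‖₊ : ℝ≥0∞) ^ 2 := fun Y => by
      rw [hg, ← ENNReal.rpow_two, ← ENNReal.rpow_mul]
      norm_num
    have hmink := ENNReal.lintegral_Lp_add_le (μ := (volume : Measure (Config n))) hfm hgm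
      (by norm_num : (1 : ℝ) ≤ 2)
    simp only [Pi.add_apply, ENNReal.rpow_two, hg2] at hmink
    refine le_trans ?_ hmink
    gcongr with Y
    exact nnnorm_integral_conj_mul_le_add hu hu1
      (measurable_comp_vecCons_left hΨ Y).aestronglyMeasurable
      (measurable_comp_vecCons_left hΦ Y).aestronglyMeasurable hc
  rw [hocc, hocc, hN, hTon, ENNReal.mul_rpow_of_nonneg _ _ (by norm_num : (0 : ℝ) ≤ 1 / 2),
    ENNReal.mul_rpow_of_nonneg _ _ (by norm_num : (0 : ℝ) ≤ 1 / 2), ← mul_add]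
  exact mul_le_mul_right key _

end SwapToZeroMode

end Summit.AtomisticToContinuum.BoseEinsteinCondensation.Theorems

end
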